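import Summits.QuantumFields.YangMills.Theorems.BalabanUVNodesN07ChartRemainderP
import Summits.QuantumFields.YangMills.Theorems.UnitScaleTiltProp8ChartDoubleBarDiffBall
import Summits.QuantumFields.YangMills.Theorems.UnitScaleTiltProp8ChartDoubleBarOneStep
import Literature.Analysis.Complex.OsgoodProofs
import HarnessLib

/-!
# K0⁷ STUB 1 (`stub_prop8StepCoP13`), sub-target S4b — **THE ♭ CHART's REMAINDER SOCKET AT THE RECORD, GENERIC CARRIER AND GENERIC FIBRE: `hCd♭ ∧ hCq♭` FOR
# `chartLogFlat` ON EVERY TORUS `P`, EVERY COMPLETE NORMED ℂ-ALGEBRA FIBRE (e.g. `M_N(ℂ)`), EVERY (2.2)-ADMISSIBLE FAMILY** — the double-bar twin of dag-n07-w2's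
# `N07ChartRemainderP` (single-bar `chartLog`), i.e. the `P`-generic ∕ `𝔸`-generic edition of the route `UnitScaleTilt`'s T3∕SU(2) bricks B2–B3
# (`Prop8ChartDoubleBar.differentiableOn_chartLogFlat_weightedBall`, `norm_chartLogFlat_le_weightedBall`, `ChartQuadraticFlat.chartRemainderFlat_hCd_hCq_B1`)

Cell `pub-ymgap`, width seat `pub-ymgap-k0-s1-w4` g0′ (FILE 12).  `--kind proof --supports stmt-QuantumFields-20541 --as helper`; count-neutral.
[15] = [Balaban1985Variational]; [B7] = [Balaban1985Averaging]; [B6] = [Balaban1984PropagatorsII].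

WHY.  After FILE 11 (`…SectFWSlotAtRecordFlatChart`, the ♭ junction over k0-s1-w2's chart socket) the ♭ W-slot of (157) displays `θ₀` (k0-s1-w2's `θ₀` socket
reduces it to kernel entries + a column sum) and the REMAINDER SOCKET of the ♭ chart: a radius `ε`, a constant `C_D`, the (55) letter `‖Dfun♭ A′ i‖ ≤ C_D·ρ′²` and
analyticity of `Dfun♭ := chartLogFlat − Qlin♭` on the `ε`-ball — at the record's tori `F.P K` with fibre `M_N(ℂ)`.  The tree holds these for the route `UnitScaleTilt`'s
`T3Family` ∕ `M₂(ℂ)` only; but its engines are generic: the one-step letter B1 (`Prop8ChartDoubleBar.norm_dbarAvgU_sub_one_le`, `C₁ = 3800`, any complete normed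
ℂ-algebra with `‖1‖ = 1`), the index-wise differentiability ∕ sup letter under a read-set budget (`differentiableAt_chartLogFlat_apply_of_reads`,
`norm_chartLogFlat_apply_le_of_reads`), dag-n07-w2's generic weighted read bound (`N07ChartRemainderP.weighted_read_bound`, `norm_expCfg_sub_one_le_of_weightedBall`)
and the Cauchy estimate on a complex line (`B7TransferAnalyticMean.norm_sub_sub_fderiv_le_of_line`).  This file assembles them for every `P` and every such fibre.

WHAT IS PROVED (sorry-free; no definition; axioms standard).  `ℓ := (d+2)L`, `R⋆♭ := (60800·ℓ²·L)⁻¹` (`= (16·C₁·ℓ²·L)⁻¹`, `C₁ = 3800`), `η = L^{−k}`.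
* §1 ★ `differentiableOn_chartLogFlat_weightedBall` — for a nested family `D` (`D.k = k`) with the collar property and the (152) weights: `chartLogFlat η D` is
  ℂ-differentiable on the weighted sup-ball `{Y | ∀ b, w 1 b·‖Y b‖ < R}` for every `R` with `60800ℓ²LR ≤ 1` (hCd♭) · ★ `norm_chartLogFlat_le_weightedBall` — the k-uniform
  sup letter `‖chartLogFlat η D A (j,c)‖ ≤ 8·L·R` there · `differentiableOn_chartLogFlat_weightedBall_of_adm22` (collar from `Adm22`, `2L ≤ R′M + 1`).
* §2 ★★ `norm_chartLogFlat_sub_fderiv_le_weightedBall` — hCq♭: `‖chartLogFlat η D Y i − (fderiv ℂ (chartLogFlat η D) 0) Y i‖ ≤ (64L∕R′)·r²` for `w₁-size(Y) ≤ r`, `0 ≤ r`,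
  `4r ≤ R′`, `60800ℓ²LR′ ≤ 1`, `R′ > 0` · ★★ `chartRemainderFlat_hCd_hCq` — both letters at every `Adm22 D R′ M` family (`2L ≤ R′`, `1 ≤ M`) on the ball of radius `R⋆♭∕4`
  with `C₂♭ := 64L∕R⋆♭`.
* §3 ★★★ `chartRemainderFlat_hCd_hCq_T4` — §2 on the record's tori `F.P K` ([Balaban1987RG1] (0.1)), any fibre as above (`M_N(ℂ)` with the operator norm included).
* §4 ★★★ `flatChartRemainderSocket_T4` — THE SOCKET's SHAPE at the fibre `M_N(ℂ)`: `ε := R⋆♭∕4 > 0`, `C_D := 64L∕R⋆♭ ≥ 0`, the (55) letter `h55` for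
  `Dfun♭ := chartLogFlat − D(chartLogFlat)(0)` (finite max of sizes) and `hcd : ContDiffOn ℂ ω Dfun♭` on the `ε`-ball (Osgood: lit `SCV.analyticOnNhd_of_differentiableOn`) —
  the binders `hε hCD Dfun h55 hcd` of k0-s1-w2's Socket ∕ FILE 11 `exists_sectF_W_atRecord_flatChart`, by `exact`.
HONEST SCOPE.  A carrier∕fibre re-typing of the route `UnitScaleTilt`'s kernel theorems and of dag-n07-w2's single-bar port (proofs ported, credited); the analytic content
([B7] Props. 3–4, the Cauchy estimate) is theirs, cited BY NAME; nothing of [15] Sects. D–F asserted; `stub_prop8StepCoP13` ∕ K0⁷ NOT closed; N07 NOT discharged; no summit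
statement is proved by this seat; counts unmoved (28∕28 · 5∕27); R4 closes the conditional finite-𝕋⁴ rung `BalabanLadder.UV` only, never the summit; the YM mass gap
(Clay) is NOT proved by any of this; nothing continuum ∕ ℝ⁴ ∕ OS.  No `sorry`, no `def`, no `instance`, no `notation`.
References: [15] (20) p.281, (44)–(48) p.285, (55) p.286, (152) p.301, (156)–(157) p.302; [B7] (62) p.28, (89) p.31, Props. 3–4 (122)–(135) pp.36–38; [B6] (2.2)–(2.3) p.224;
[Balaban1987RG1] (0.1) p.251.
-/

noncomputable section

open scoped BigOperators
open NormedSpace Metric Set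

namespace Summit.QuantumFields.YangMills.Theorems.K0Stub1FlatChartRemainderP

open Literature.MathematicalPhysics.QuantumFieldTheory.Balaban1983to89
open Literature.MathematicalPhysics.QuantumFieldTheory.Balaban1983to89.T4Continuum (T4Family)
open Literature.MathematicalPhysics.QuantumFieldTheory.Balaban1983to89.B6SectADomainsV1 (Domains)
open Literature.MathematicalPhysics.QuantumFieldTheory.Balaban1983to89.B6SectAOperatorsV1 (BondIdx)
open Literature.MathematicalPhysics.QuantumFieldTheory.Balaban1983to89.B5Eq118OneStroke (iterBlockOf)
open Summit.QuantumFields.YangMills.Theorems.FlatCubeOpsText (Adm22)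
open Summit.QuantumFields.YangMills.Theorems.K0FlatCubeOpsTextP (IsLevWeight)
open Summit.QuantumFields.YangMills.Theorems.Prop8Chart (expCfg collar_of_adm22)
open Summit.QuantumFields.YangMills.Theorems.Prop8ChartDoubleBar (chartLogFlat chartLogFlat_zero
  differentiableAt_chartLogFlat_apply_of_reads norm_chartLogFlat_apply_le_of_reads norm_dbarAvgU_sub_one_le dbarAvgU)
open Summit.QuantumFields.YangMills.BalabanUVNodes.N07ChartRemainderP (weighted_read_bound norm_expCfg_sub_one_le_of_weightedBall)

variable {P : Params}

/-! ## §1  hCd♭ on the weighted ball (generic carrier, generic fibre) and the k-uniform sup letter -/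

section Weighted

variable {𝔸 : Type*} [NormedRing 𝔸] [NormedAlgebra ℂ 𝔸] [CompleteSpace 𝔸] [NormOneClass 𝔸]

/-- The one-step letter `hstep` of the ♭ engines, DISCHARGED by brick B1 (`Prop8ChartDoubleBar.norm_dbarAvgU_sub_one_le`, `C₁ = 3800`) in every complete normed ℂ-algebra
with `‖1‖ = 1`. [cite: Balaban1985Averaging, (62) p.28, (89) p.31, Prop. 3 (122)-(125) p.36] -/
theorem hstep_B1 :
    ∀ (j : ℕ), j + 1 ≤ P.m + P.K → ∀ (S : GaugeField P j 𝔸ˣ) (c : PBond P (j + 1)) (s : ℝ), 0 ≤ s →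
      48 * (((P.d + 2) * P.L : ℕ) : ℝ) * s ≤ 1 →
      (∀ b : PBond P j, (blockOf b.src = c.src ∨ blockOf b.src = c.tgt) → (blockOf b.tgt = c.src ∨ blockOf b.tgt = c.tgt) →
        ‖((S b : 𝔸ˣ) : 𝔸) - 1‖ ≤ s) →
      ‖((dbarAvgU S c : 𝔸ˣ) : 𝔸) - 1‖ ≤ (P.L : ℝ) * s + 3800 * (((P.d + 2) * P.L : ℕ) : ℝ) ^ 2 * s ^ 2 :=
  fun _ hj _ c _ hs0 hℓs hS => norm_dbarAvgU_sub_one_le hj c hs0 hℓs hS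

/-- ★ **hCd♭, GENERIC CARRIER AND FIBRE**: for a nested family `D` with `D.k = k` and the collar property, the weights `K0FlatCubeOpsTextP.IsLevWeight P k D w`, and every
radius with `60800·ℓ²·L·R ≤ 1` (`ℓ = (d+2)L`; k-UNIFORM), the double-bar constraint map `chartLogFlat η D`, `η = L^{−k}`, is ℂ-differentiable on the weighted sup-ball
`{Y | ∀ b, w 1 b·‖Y b‖ < R}` (engines: `differentiableAt_chartLogFlat_apply_of_reads` over B1; read bound `N07ChartRemainderP.norm_expCfg_sub_one_le_of_weightedBall`; same
proof as the route's T3 theorem). [cite: Balaban1985Variational, (20) p.281, (44)-(48) p.285, (156)-(157) p.302; Balaban1985Averaging, Prop. 4 p.38] -/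
theorem differentiableOn_chartLogFlat_weightedBall (k : ℕ) (D : Domains P) (hDk : D.k = k)
    (hcollar : ∀ (i : ℕ) (e : PBond P (i + 1)), D.LamBond (i + 1) e → ∀ z : Site P i, (blockOf z = e.src ∨ blockOf z = e.tgt) → z ∈ D.Om i)
    {w : ℕ → PBond P 0 → ℝ} (hw : IsLevWeight P k D w) {R : ℝ} (hR : 60800 * (((P.d + 2) * P.L : ℕ) : ℝ) ^ 2 * (P.L : ℝ) * R ≤ 1) :
    DifferentiableOn ℂ (chartLogFlat (((P.L : ℝ)⁻¹) ^ k) D : (PBond P 0 → 𝔸) → BondIdx D → 𝔸) {Y | ∀ b, w 1 b * ‖Y b‖ < R} := by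
  have hL1 : (1 : ℝ) ≤ P.L := by exact_mod_cast P.L_pos
  have hL0 : (0 : ℝ) < P.L := by linarith
  intro A₀ hA₀
  refine (differentiableAt_pi.mpr fun idx => ?_).differentiableWithinAt
  have hLj : 0 < (P.L : ℝ) ^ (idx.1.1 : ℕ) := by positivity
  have hR0 : 0 ≤ R := by
    have := hA₀ (⟨fun _ => 0, idx.1.2.dir⟩ : PBond P 0)
    have hw0 : 0 ≤ w 1 ⟨fun _ => 0, idx.1.2.dir⟩ * ‖A₀ ⟨fun _ => 0, idx.1.2.dir⟩‖ := by
      rw [hw 1, pow_one]; exact mul_nonneg (by positivity) (norm_nonneg _)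
    linarith
  have hden0 : 0 ≤ (((P.d + 2) * P.L : ℕ) : ℝ) ^ 2 * (P.L : ℝ) * R := by positivity
  have hR' : 12800 * (((P.d + 2) * P.L : ℕ) : ℝ) ^ 2 * (P.L : ℝ) * R ≤ 1 := by nlinarith
  set s₀ : ℝ := 2 * (P.L : ℝ) * R * ((P.L : ℝ) ^ (idx.1.1 : ℕ))⁻¹ with hs₀
  have hs₀0 : 0 ≤ s₀ := by positivity
  have hbudget : 8 * 3800 * (((P.d + 2) * P.L : ℕ) : ℝ) ^ 2 * (P.L : ℝ) ^ (idx.1.1 : ℕ) * s₀ ≤ 1 := by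
    have : 8 * 3800 * (((P.d + 2) * P.L : ℕ) : ℝ) ^ 2 * (P.L : ℝ) ^ (idx.1.1 : ℕ) * s₀ =
        60800 * (((P.d + 2) * P.L : ℕ) : ℝ) ^ 2 * (P.L : ℝ) * R := by
      rw [hs₀]; field_simp; ring
    rw [this]; exact hR
  have hA : ∀ b : PBond P 0, (iterBlockOf (idx.1.1 : ℕ) b.src = idx.1.2.src ∨ iterBlockOf (idx.1.1 : ℕ) b.src = idx.1.2.tgt) →
      (iterBlockOf (idx.1.1 : ℕ) b.tgt = idx.1.2.src ∨ iterBlockOf (idx.1.1 : ℕ) b.tgt = idx.1.2.tgt) →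
      ‖((expCfg (((P.L : ℝ)⁻¹) ^ k) A₀ b : 𝔸ˣ) : 𝔸) - 1‖ ≤ s₀ :=
    fun b hb _ => norm_expCfg_sub_one_le_of_weightedBall k D hDk hcollar hw hR' hA₀ idx b hb
  exact (differentiableAt_chartLogFlat_apply_of_reads _ (by norm_num : (2 : ℝ) ≤ 3800) hstep_B1 D idx A₀ hs₀0 hbudget hA).1

/-- ★ **THE k-UNIFORM SUP LETTER ON THE WEIGHTED BALL**: `‖chartLogFlat η D A (j,c)‖ ≤ 8·L·R` at every index, for every `A` in the weighted ball of radius `R`,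
`60800·ℓ²·L·R ≤ 1` — the bound hCq♭'s Cauchy estimate starts from; no comb factor (`norm_chartLogFlat_apply_le_of_reads` over B1).
[cite: Balaban1985Variational, (20) p.281, (44)-(47) p.285] -/
theorem norm_chartLogFlat_le_weightedBall (k : ℕ) (D : Domains P) (hDk : D.k = k)
    (hcollar : ∀ (i : ℕ) (e : PBond P (i + 1)), D.LamBond (i + 1) e → ∀ z : Site P i, (blockOf z = e.src ∨ blockOf z = e.tgt) → z ∈ D.Om i)
    {w : ℕ → PBond P 0 → ℝ} (hw : IsLevWeight P k D w) {R : ℝ} (hR : 60800 * (((P.d + 2) * P.L : ℕ) : ℝ) ^ 2 * (P.L : ℝ) * R ≤ 1)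
    {A : PBond P 0 → 𝔸} (hA : ∀ b, w 1 b * ‖A b‖ < R) (idx : BondIdx D) :
    ‖chartLogFlat (((P.L : ℝ)⁻¹) ^ k) D A idx‖ ≤ 8 * (P.L : ℝ) * R := by
  have hL1 : (1 : ℝ) ≤ P.L := by exact_mod_cast P.L_pos
  have hL0 : (0 : ℝ) < P.L := by linarith
  have hLj : 0 < (P.L : ℝ) ^ (idx.1.1 : ℕ) := by positivity
  have hR0 : 0 ≤ R := by
    have := hA (⟨fun _ => 0, idx.1.2.dir⟩ : PBond P 0)
    have hw0 : 0 ≤ w 1 ⟨fun _ => 0, idx.1.2.dir⟩ * ‖A ⟨fun _ => 0, idx.1.2.dir⟩‖ := by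
      rw [hw 1, pow_one]; exact mul_nonneg (by positivity) (norm_nonneg _)
    linarith
  have hden0 : 0 ≤ (((P.d + 2) * P.L : ℕ) : ℝ) ^ 2 * (P.L : ℝ) * R := by positivity
  have hR' : 12800 * (((P.d + 2) * P.L : ℕ) : ℝ) ^ 2 * (P.L : ℝ) * R ≤ 1 := by nlinarith
  set s₀ : ℝ := 2 * (P.L : ℝ) * R * ((P.L : ℝ) ^ (idx.1.1 : ℕ))⁻¹ with hs₀
  have hs₀0 : 0 ≤ s₀ := by positivity
  have hbudget : 8 * 3800 * (((P.d + 2) * P.L : ℕ) : ℝ) ^ 2 * (P.L : ℝ) ^ (idx.1.1 : ℕ) * s₀ ≤ 1 := by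
    have : 8 * 3800 * (((P.d + 2) * P.L : ℕ) : ℝ) ^ 2 * (P.L : ℝ) ^ (idx.1.1 : ℕ) * s₀ =
        60800 * (((P.d + 2) * P.L : ℕ) : ℝ) ^ 2 * (P.L : ℝ) * R := by
      rw [hs₀]; field_simp; ring
    rw [this]; exact hR
  have hA' : ∀ b : PBond P 0, (iterBlockOf (idx.1.1 : ℕ) b.src = idx.1.2.src ∨ iterBlockOf (idx.1.1 : ℕ) b.src = idx.1.2.tgt) →
      (iterBlockOf (idx.1.1 : ℕ) b.tgt = idx.1.2.src ∨ iterBlockOf (idx.1.1 : ℕ) b.tgt = idx.1.2.tgt) →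
      ‖((expCfg (((P.L : ℝ)⁻¹) ^ k) A b : 𝔸ˣ) : 𝔸) - 1‖ ≤ s₀ :=
    fun b hb _ => norm_expCfg_sub_one_le_of_weightedBall k D hDk hcollar hw hR' hA idx b hb
  have h := norm_chartLogFlat_apply_le_of_reads (((P.L : ℝ)⁻¹) ^ k) (by norm_num : (2 : ℝ) ≤ 3800) hstep_B1 D idx A hs₀0 hbudget hA'
  calc _ ≤ 4 * ((P.L : ℝ) ^ (idx.1.1 : ℕ) * s₀) := h
    _ = 8 * (P.L : ℝ) * R := by rw [hs₀]; field_simp; ring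

/-- hCd♭ for EVERY (2.2)-admissible family (`Adm22 D R′ M`, `2L ≤ R′·M + 1`), radius `R ≤ 1∕(60800ℓ²L)`. [cite: Balaban1985Variational, (44)-(48) p.285; Balaban1984PropagatorsII, (2.2) p.224] -/
theorem differentiableOn_chartLogFlat_weightedBall_of_adm22 (k : ℕ) (D : Domains P) (hDk : D.k = k) {R' M : ℕ}
    (hAdm : Adm22 D R' M) (hRM : 2 * P.L ≤ R' * M + 1)
    {w : ℕ → PBond P 0 → ℝ} (hw : IsLevWeight P k D w) {R : ℝ} (hR : 60800 * (((P.d + 2) * P.L : ℕ) : ℝ) ^ 2 * (P.L : ℝ) * R ≤ 1) :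
    DifferentiableOn ℂ (chartLogFlat (((P.L : ℝ)⁻¹) ^ k) D : (PBond P 0 → 𝔸) → BondIdx D → 𝔸) {Y | ∀ b, w 1 b * ‖Y b‖ < R} :=
  differentiableOn_chartLogFlat_weightedBall k D hDk (collar_of_adm22 D hAdm hRM) hw hR

end Weighted

/-! ## §2  hCq♭: the k-uniform quadratic remainder on the weighted ball (Cauchy estimate), and both letters assembled -/

section Quadratic

variable {𝔸 : Type*} [NormedRing 𝔸] [NormedAlgebra ℂ 𝔸] [CompleteSpace 𝔸] [NormOneClass 𝔸]

/-- ★★ **hCq♭, GENERIC CARRIER AND FIBRE: THE k-UNIFORM QUADRATIC REMAINDER OF THE ♭ CHART ON THE WEIGHTED BALL.**  For a nested family `D` with `D.k = k` and the collar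
property, the weights `w`, a radius `R′ > 0` with `60800·ℓ²·L·R′ ≤ 1`, and every `Y` with `w 1 b·‖Y b‖ ≤ r` for all `b`, `0 ≤ r`, `4r ≤ R′`:
`‖chartLogFlat η D Y i − (fderiv ℂ (chartLogFlat η D) 0) Y i‖ ≤ (64L∕R′)·r²` at every index `i` (`η = L^{−k}`) — (44) for the chart OF RECORD, by the Cauchy estimate along
the complex line through the weighting isomorphism (`B7TransferAnalyticMean.norm_sub_sub_fderiv_le_of_line`; same proof as dag-n07-w2's single-bar generic theorem).
[cite: Balaban1985Variational, (44) p.285, (47)-(48) p.285; Balaban1985Averaging, Prop. 3 (122)-(123) p.36, Prop. 4 (134)-(135) p.38] -/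
theorem norm_chartLogFlat_sub_fderiv_le_weightedBall (k : ℕ) (D : Domains P) (hDk : D.k = k)
    (hcollar : ∀ (i : ℕ) (e : PBond P (i + 1)), D.LamBond (i + 1) e → ∀ z : Site P i, (blockOf z = e.src ∨ blockOf z = e.tgt) → z ∈ D.Om i)
    {w : ℕ → PBond P 0 → ℝ} (hw : IsLevWeight P k D w) {R' : ℝ} (hR' : 60800 * (((P.d + 2) * P.L : ℕ) : ℝ) ^ 2 * (P.L : ℝ) * R' ≤ 1)
    (hR'0 : 0 < R') (Y : PBond P 0 → 𝔸) {r : ℝ} (hr0 : 0 ≤ r) (hr : 4 * r ≤ R') (hY : ∀ b, w 1 b * ‖Y b‖ ≤ r)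
    (i : BondIdx D) :
    ‖chartLogFlat (((P.L : ℝ)⁻¹) ^ k) D Y i -
        (fderiv ℂ (chartLogFlat (((P.L : ℝ)⁻¹) ^ k) D : (PBond P 0 → 𝔸) → BondIdx D → 𝔸) 0) Y i‖ ≤
      64 * (P.L : ℝ) / R' * r ^ 2 := by
  -- letters
  set η : ℝ := ((P.L : ℝ)⁻¹) ^ k with hη
  have hwpos : ∀ b, 0 < w 1 b := fun b => by
    rw [hw 1 b, pow_one]
    have hL : (0 : ℝ) < P.L := by exact_mod_cast P.L_pos
    positivity
  -- the weighting isomorphism `T Z = (w⁻¹·Z)` and the preimage `Z` of `Y`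
  set T : (PBond P 0 → 𝔸) →L[ℂ] (PBond P 0 → 𝔸) :=
    ContinuousLinearMap.pi fun b => ((w 1 b : ℂ)⁻¹) • ContinuousLinearMap.proj (R := ℂ) (φ := fun _ => 𝔸) b with hT
  have hT_apply : ∀ (Z : PBond P 0 → 𝔸) (b : PBond P 0), T Z b = ((w 1 b : ℂ)⁻¹) • Z b := fun Z b => rfl
  set Z : (PBond P 0 → 𝔸) := fun b => (w 1 b : ℂ) • Y b with hZ
  have hTZ : T Z = Y := by
    funext b
    rw [hT_apply, hZ]
    simp only [smul_smul]
    rw [inv_mul_cancel₀ (by exact_mod_cast (hwpos b).ne'), one_smul]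
  have hZnorm : ‖Z‖ ≤ r := by
    refine (pi_norm_le_iff_of_nonneg hr0).2 fun b => ?_
    rw [hZ]; simp only [norm_smul, Complex.norm_real, Real.norm_eq_abs, abs_of_pos (hwpos b)]
    exact hY b
  -- the component map through the weighting
  set g : (PBond P 0 → 𝔸) → 𝔸 := fun A => chartLogFlat η D A i with hg
  set Φ : (PBond P 0 → 𝔸) → 𝔸 := fun X => g (T X) with hΦ
  have hmaps : ∀ X : PBond P 0 → 𝔸, X ∈ ball (0 : PBond P 0 → 𝔸) R' → ∀ b, w 1 b * ‖T X b‖ < R' := by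
    intro X hX b
    rw [mem_ball_zero_iff] at hX
    rw [hT_apply, norm_smul, norm_inv, Complex.norm_real, Real.norm_eq_abs, abs_of_pos (hwpos b), ← mul_assoc,
      mul_inv_cancel₀ (hwpos b).ne', one_mul]
    exact (norm_le_pi_norm X b).trans_lt hX
  have hdiffOn := differentiableOn_chartLogFlat_weightedBall (𝔸 := 𝔸) k D hDk hcollar hw hR'
  have hopen : IsOpen {Y : PBond P 0 → 𝔸 | ∀ b, w 1 b * ‖Y b‖ < R'} := by
    have : {Y : PBond P 0 → 𝔸 | ∀ b, w 1 b * ‖Y b‖ < R'} = ⋂ b, {Y : PBond P 0 → 𝔸 | w 1 b * ‖Y b‖ < R'} := by ext Y; simp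
    rw [this]
    exact isOpen_iInter_of_finite fun b => isOpen_lt (continuous_const.mul (continuous_apply b).norm) continuous_const
  have h0w : (0 : PBond P 0 → 𝔸) ∈ {Y : PBond P 0 → 𝔸 | ∀ b, w 1 b * ‖Y b‖ < R'} := fun b => by
    rw [Pi.zero_apply, norm_zero, mul_zero]; exact hR'0
  have hdiff0 : DifferentiableAt ℂ (chartLogFlat η D : (PBond P 0 → 𝔸) → BondIdx D → 𝔸) 0 :=
    (hdiffOn 0 h0w).differentiableAt (hopen.mem_nhds h0w)
  have hΦd : DifferentiableOn ℂ Φ (ball (0 : PBond P 0 → 𝔸) R') := by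
    intro X hX
    have hgX : DifferentiableAt ℂ g (T X) := by
      have h := hdiffOn (T X) (hmaps X hX)
      have hd := (h.differentiableAt (hopen.mem_nhds (hmaps X hX)))
      exact (differentiableAt_pi.mp hd) i
    exact (hgX.comp X T.differentiableAt).differentiableWithinAt
  have hΦB : ∀ X ∈ ball (0 : PBond P 0 → 𝔸) R', ‖Φ X‖ ≤ 8 * (P.L : ℝ) * R' := fun X hX =>
    norm_chartLogFlat_le_weightedBall k D hDk hcollar hw hR' (hmaps X hX) i
  -- the Cauchy estimate along the line `t ↦ t•Z`
  have h0 : (0 : PBond P 0 → 𝔸) ∈ ball (0 : PBond P 0 → 𝔸) R' := mem_ball_self hR'0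
  have hv : 4 * ‖Z‖ ≤ R' - ‖(0 : PBond P 0 → 𝔸) - 0‖ := by rw [sub_zero, norm_zero, sub_zero]; linarith
  have hC := B7TransferAnalyticMean.norm_sub_sub_fderiv_le_of_line hΦd hΦB h0 hv
  rw [zero_add, sub_self, norm_zero, sub_zero] at hC
  -- identify the three terms
  have hΦZ : Φ Z = chartLogFlat η D Y i := by rw [hΦ]; simp only [hg]; rw [hTZ]
  have hΦ0 : Φ 0 = 0 := by rw [hΦ]; simp only [hg, map_zero, chartLogFlat_zero, Pi.zero_apply]
  have hg0 : DifferentiableAt ℂ g 0 := (differentiableAt_pi.mp hdiff0) i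
  have hfd : fderiv ℂ Φ 0 Z = (fderiv ℂ (chartLogFlat η D : (PBond P 0 → 𝔸) → BondIdx D → 𝔸) 0) Y i := by
    have h1 : fderiv ℂ Φ 0 = (fderiv ℂ g (T 0)).comp T := by
      rw [hΦ]
      exact fderiv_comp 0 (by rw [map_zero]; exact hg0) T.differentiableAt |>.trans (by rw [T.fderiv])
    rw [h1, ContinuousLinearMap.comp_apply, map_zero, hTZ]
    have h2 : fderiv ℂ g 0 = (ContinuousLinearMap.proj (R := ℂ) (φ := fun _ : BondIdx D => 𝔸) i).comp
        (fderiv ℂ (chartLogFlat η D : (PBond P 0 → 𝔸) → BondIdx D → 𝔸) 0) :=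
      ((hasFDerivAt_pi'.mp hdiff0.hasFDerivAt) i).fderiv
    rw [h2, ContinuousLinearMap.comp_apply, ContinuousLinearMap.proj_apply]
  rw [hΦZ, hΦ0, sub_zero, hfd] at hC
  refine hC.trans ?_
  -- `8·(8LR′)·‖Z‖²/R′² ≤ (64L/R′)·r²`
  have hZ2 : ‖Z‖ ^ 2 ≤ r ^ 2 := pow_le_pow_left₀ (norm_nonneg _) hZnorm 2
  have hL0 : (0 : ℝ) ≤ P.L := Nat.cast_nonneg _
  have heq : 8 * (8 * (P.L : ℝ) * R') * ‖Z‖ ^ 2 / R' ^ 2 = 64 * (P.L : ℝ) / R' * ‖Z‖ ^ 2 := by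
    field_simp
    ring
  rw [heq]
  gcongr

/-- ★★ **hCd♭ ∧ hCq♭ ASSEMBLED, GENERIC CARRIER AND FIBRE**, constants in `d` and `L` only: for every `k`, every `R′ ≥ 2L`, `M ≥ 1`, every nested family `D` with `D.k = k`
admissible `Adm22 D R′ M`, and the weights `w`: with `R⋆♭ := 1∕(60800ℓ²L)`, `R := R⋆♭∕4`, `C₂♭ := 64L∕R⋆♭`, the ♭ chart `chartLogFlat η D` (`η = L^{−k}`) is ℂ-differentiable on
the weighted ball of radius `R` and satisfies the quadratic-remainder letter there — the two `C`-inputs (`hcd` after `ContDiffOn`-upgrade on the open ball, and (55) `h55`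
with `Dfun♭ := chartLogFlat − D(chartLogFlat)(0)`) of k0-s1-w2's chart socket ∕ FILE 11 for the chart OF RECORD. [cite: Balaban1985Variational, (44)-(48) p.285, (55) p.286, Prop. 3 p.289] -/
theorem chartRemainderFlat_hCd_hCq (k : ℕ) {R' M : ℕ} (hR'L : 2 * P.L ≤ R') (hM : 1 ≤ M) (D : Domains P) (hDk : D.k = k) (hAdm : Adm22 D R' M)
    {w : ℕ → PBond P 0 → ℝ} (hw : IsLevWeight P k D w) :
    let Rs : ℝ := (60800 * (((P.d + 2) * P.L : ℕ) : ℝ) ^ 2 * (P.L : ℝ))⁻¹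
    DifferentiableOn ℂ (chartLogFlat (((P.L : ℝ)⁻¹) ^ k) D : (PBond P 0 → 𝔸) → BondIdx D → 𝔸) {Y | ∀ b, w 1 b * ‖Y b‖ < Rs / 4} ∧
      ∀ (Y : PBond P 0 → 𝔸) (r : ℝ), r < Rs / 4 → (∀ b, w 1 b * ‖Y b‖ ≤ r) →
        ∀ i : BondIdx D,
          ‖chartLogFlat (((P.L : ℝ)⁻¹) ^ k) D Y i - (fderiv ℂ (chartLogFlat (((P.L : ℝ)⁻¹) ^ k) D : (PBond P 0 → 𝔸) → BondIdx D → 𝔸) 0) Y i‖ ≤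
            (64 * (P.L : ℝ) / Rs) * r ^ 2 := by
  intro Rs
  have hL1 : (1 : ℝ) ≤ P.L := by exact_mod_cast P.L_pos
  have hℓ1 : (1 : ℝ) ≤ (((P.d + 2) * P.L : ℕ) : ℝ) := by
    exact_mod_cast Nat.one_le_iff_ne_zero.mpr (Nat.mul_ne_zero (by omega) (by have := P.hL.2; omega))
  have hden : 0 < 60800 * (((P.d + 2) * P.L : ℕ) : ℝ) ^ 2 * (P.L : ℝ) := by positivity
  have hRs0 : 0 < Rs := inv_pos.mpr hden
  have hRs : 60800 * (((P.d + 2) * P.L : ℕ) : ℝ) ^ 2 * (P.L : ℝ) * Rs ≤ 1 := by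
    show 60800 * (((P.d + 2) * P.L : ℕ) : ℝ) ^ 2 * (P.L : ℝ) * (60800 * (((P.d + 2) * P.L : ℕ) : ℝ) ^ 2 * (P.L : ℝ))⁻¹ ≤ 1
    rw [mul_inv_cancel₀ hden.ne']
  have hRs4 : 60800 * (((P.d + 2) * P.L : ℕ) : ℝ) ^ 2 * (P.L : ℝ) * (Rs / 4) ≤ 1 := by
    have : Rs / 4 ≤ Rs := by linarith
    exact le_trans (mul_le_mul_of_nonneg_left this hden.le) hRs
  have hRM : 2 * P.L ≤ R' * M + 1 := by
    have : R' ≤ R' * M := Nat.le_mul_of_pos_right R' hM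
    omega
  have hcollar := collar_of_adm22 D hAdm hRM
  refine ⟨differentiableOn_chartLogFlat_weightedBall k D hDk hcollar hw hRs4, fun Y r hr hY i => ?_⟩
  rcases lt_or_ge r 0 with hneg | hr0
  · exfalso
    have h := hY ⟨fun _ => 0, i.1.2.dir⟩
    have hw0 : 0 ≤ w 1 ⟨fun _ => 0, i.1.2.dir⟩ * ‖Y ⟨fun _ => 0, i.1.2.dir⟩‖ := by
      rw [hw 1, pow_one]
      have hL : (0 : ℝ) < P.L := by linarith
      exact mul_nonneg (by positivity) (norm_nonneg _)
    linarith
  exact norm_chartLogFlat_sub_fderiv_le_weightedBall k D hDk hcollar hw hRs hRs0 Y hr0 (by linarith) hY i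

end Quadratic

/-! ## §3  At the record: the T⁴ tori `F.P K` -/

section Record

variable {𝔸 : Type*} [NormedRing 𝔸] [NormedAlgebra ℂ 𝔸] [CompleteSpace 𝔸] [NormOneClass 𝔸]

/-- ★★★ **THE ♭ CHART's REMAINDER LETTERS AT THE RECORD**: §2 on the T⁴ torus `F.P K` of a `T4Family` ([Balaban1987RG1] (0.1)), any height `k`, any nested family
`D : Domains (F.P K)` with `D.k = k` admissible in the sense (2.2) (`2L ≤ R′`, `1 ≤ M`), any complete normed `ℂ`-algebra fibre with `‖1‖ = 1` (e.g. `M_N(ℂ)` with the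
operator norm, `N ≥ 1`): hCd♭ on the weighted ball of radius `R⋆♭∕4` and hCq♭ with `C₂♭ = 64L∕R⋆♭`, `R⋆♭ = (60800ℓ²L)⁻¹` — the remainder socket's analytic inputs for the
chart OF RECORD, k-UNIFORM. [cite: Balaban1985Variational, (44)-(48) p.285, (55) p.286, (157) p.302; Balaban1987RG1, (0.1) p.251] -/
theorem chartRemainderFlat_hCd_hCq_T4 (F : T4Family) (K k : ℕ) {R' M : ℕ} (hR'L : 2 * (F.P K).L ≤ R') (hM : 1 ≤ M) (D : Domains (F.P K))
    (hDk : D.k = k) (hAdm : Adm22 D R' M) {w : ℕ → PBond (F.P K) 0 → ℝ} (hw : IsLevWeight (F.P K) k D w) :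
    let Rs : ℝ := (60800 * ((((F.P K).d + 2) * (F.P K).L : ℕ) : ℝ) ^ 2 * ((F.P K).L : ℝ))⁻¹
    DifferentiableOn ℂ (chartLogFlat ((((F.P K).L : ℝ)⁻¹) ^ k) D : (PBond (F.P K) 0 → 𝔸) → BondIdx D → 𝔸) {Y | ∀ b, w 1 b * ‖Y b‖ < Rs / 4} ∧
      ∀ (Y : PBond (F.P K) 0 → 𝔸) (r : ℝ), r < Rs / 4 → (∀ b, w 1 b * ‖Y b‖ ≤ r) →
        ∀ i : BondIdx D,
          ‖chartLogFlat ((((F.P K).L : ℝ)⁻¹) ^ k) D Y i -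
              (fderiv ℂ (chartLogFlat ((((F.P K).L : ℝ)⁻¹) ^ k) D : (PBond (F.P K) 0 → 𝔸) → BondIdx D → 𝔸) 0) Y i‖ ≤
            (64 * ((F.P K).L : ℝ) / Rs) * r ^ 2 :=
  chartRemainderFlat_hCd_hCq (P := F.P K) k hR'L hM D hDk hAdm hw

end Record

/-! ## §4  The remainder socket's shape at the fibre `M_N(ℂ)`: `ε`, `C_D`, (55) and analyticity of `Dfun♭ = chartLogFlat − D(chartLogFlat)(0)` -/

section Socket

open scoped Matrix.Norms.L2Operator ContDiff

/-- ★★★ **THE ♭ REMAINDER SOCKET AT THE RECORD, FIBRE `M_N(ℂ)`** — for every `F : T4Family`, `N ≥ 1`, heights `K, k`, every nested family `D : Domains (F.P K)` with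
`D.k = k` admissible `Adm22 D R′ M` (`2L ≤ R′`, `1 ≤ M`) and the (152) weights: with `R⋆♭ := (60800ℓ²L)⁻¹`, `ε := R⋆♭∕4`, `C_D := 64L∕R⋆♭` and
`Dfun♭ A := chartLogFlat η D A − (fderiv ℂ (chartLogFlat η D) 0) A` (`η = L^{−k}`): `0 < ε`, `0 ≤ C_D`, the (55) letter
`(∀ b, w₁(b)‖A′ b‖ < ε) → ∀ ρ′ ≥ 0, (∀ b, w₁(b)‖A′ b‖ ≤ ρ′) → ∀ i, ‖Dfun♭ A′ i‖ ≤ C_D·ρ′²` and `ContDiffOn ℂ ω Dfun♭ {Y | ∀ b, w₁(b)‖Y b‖ < ε}` — EXACTLY the binders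
`hε hCD Dfun h55 hcd` of k0-s1-w2's chart socket ∕ FILE 11's ♭ junction, k-UNIFORM (§3 + the finite max of sizes + Osgood's lemma, lit `SCV.analyticOnNhd_of_differentiableOn`).
[cite: Balaban1985Variational, (44)-(48) p.285, (55) p.286, (157) p.302; Balaban1987RG1, (0.1) p.251] -/
theorem flatChartRemainderSocket_T4 (N : ℕ) [NeZero N] (F : T4Family) (K k : ℕ) {R' M : ℕ} (hR'L : 2 * (F.P K).L ≤ R') (hM : 1 ≤ M) (D : Domains (F.P K))
    (hDk : D.k = k) (hAdm : Adm22 D R' M) {w : ℕ → PBond (F.P K) 0 → ℝ} (hw : IsLevWeight (F.P K) k D w) :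
    let Rs : ℝ := (60800 * ((((F.P K).d + 2) * (F.P K).L : ℕ) : ℝ) ^ 2 * ((F.P K).L : ℝ))⁻¹
    0 < Rs / 4 ∧ 0 ≤ 64 * ((F.P K).L : ℝ) / Rs ∧
    (∀ A' : PBond (F.P K) 0 → Matrix (Fin N) (Fin N) ℂ, (∀ b, w 1 b * ‖A' b‖ < Rs / 4) →
      ∀ ρ' : ℝ, 0 ≤ ρ' → (∀ b, w 1 b * ‖A' b‖ ≤ ρ') → ∀ i : BondIdx D,
        ‖(fun A : PBond (F.P K) 0 → Matrix (Fin N) (Fin N) ℂ => chartLogFlat ((((F.P K).L : ℝ)⁻¹) ^ k) D A -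
            (fderiv ℂ (chartLogFlat ((((F.P K).L : ℝ)⁻¹) ^ k) D : (PBond (F.P K) 0 → Matrix (Fin N) (Fin N) ℂ) → BondIdx D → Matrix (Fin N) (Fin N) ℂ) 0) A) A' i‖ ≤
          (64 * ((F.P K).L : ℝ) / Rs) * ρ' ^ 2) ∧
    ContDiffOn ℂ ω (fun A : PBond (F.P K) 0 → Matrix (Fin N) (Fin N) ℂ => chartLogFlat ((((F.P K).L : ℝ)⁻¹) ^ k) D A -
        (fderiv ℂ (chartLogFlat ((((F.P K).L : ℝ)⁻¹) ^ k) D : (PBond (F.P K) 0 → Matrix (Fin N) (Fin N) ℂ) → BondIdx D → Matrix (Fin N) (Fin N) ℂ) 0) A)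
      {Y : PBond (F.P K) 0 → Matrix (Fin N) (Fin N) ℂ | ∀ b, w 1 b * ‖Y b‖ < Rs / 4} := by
  intro Rs
  have hL1 : (1 : ℝ) ≤ (F.P K).L := by exact_mod_cast (F.P K).L_pos
  have hℓ1 : (1 : ℝ) ≤ ((((F.P K).d + 2) * (F.P K).L : ℕ) : ℝ) := by
    exact_mod_cast Nat.one_le_iff_ne_zero.mpr (Nat.mul_ne_zero (by omega) (by have := (F.P K).hL.2; omega))
  have hden : 0 < 60800 * ((((F.P K).d + 2) * (F.P K).L : ℕ) : ℝ) ^ 2 * ((F.P K).L : ℝ) := by positivity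
  have hRs0 : 0 < Rs := inv_pos.mpr hden
  have hCD0 : 0 ≤ 64 * ((F.P K).L : ℝ) / Rs := div_nonneg (by positivity) hRs0.le
  have hwpos : ∀ b, 0 < w 1 b := fun b => by rw [hw 1 b, pow_one]; positivity
  obtain ⟨hdiff, hquad⟩ := chartRemainderFlat_hCd_hCq_T4 (𝔸 := Matrix (Fin N) (Fin N) ℂ) F K k hR'L hM D hDk hAdm hw
  refine ⟨by linarith, hCD0, fun A' hA' ρ' hρ' hA'ρ i => ?_, ?_⟩
  · -- the (55) letter: a size `ρ₀ < ε` of `A′` exists (finite max), and the bound at `min ρ₀ ρ′` is `≤ C_D·ρ′²`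
    classical
    have hd : 0 < (F.P K).d := by have := T4Family.P_d F K; omega
    obtain ⟨b₀, -, hmax⟩ := Finset.exists_max_image Finset.univ (fun b : PBond (F.P K) 0 => w 1 b * ‖A' b‖) ⟨⟨fun _ => 0, ⟨0, hd⟩⟩, Finset.mem_univ _⟩
    set ρ₀ : ℝ := w 1 b₀ * ‖A' b₀‖ with hρ₀
    have hρ₀0 : 0 ≤ ρ₀ := mul_nonneg (hwpos b₀).le (norm_nonneg _)
    have hmin : ∀ b, w 1 b * ‖A' b‖ ≤ min ρ₀ ρ' := fun b => le_min (hmax b (Finset.mem_univ b)) (hA'ρ b)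
    have h := hquad A' (min ρ₀ ρ') (lt_of_le_of_lt (min_le_left _ _) (hA' b₀)) hmin i
    refine (le_of_eq (by simp only [Pi.sub_apply])).trans (h.trans (mul_le_mul_of_nonneg_left ?_ hCD0))
    exact pow_le_pow_left₀ (le_min hρ₀0 hρ') (min_le_right _ _) 2
  · -- analyticity on the open weighted ball (Osgood) ⇒ `C^ω`; minus a continuous linear map
    have hopen : IsOpen {Y : PBond (F.P K) 0 → Matrix (Fin N) (Fin N) ℂ | ∀ b, w 1 b * ‖Y b‖ < Rs / 4} := by
      have : {Y : PBond (F.P K) 0 → Matrix (Fin N) (Fin N) ℂ | ∀ b, w 1 b * ‖Y b‖ < Rs / 4} =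
          ⋂ b, {Y : PBond (F.P K) 0 → Matrix (Fin N) (Fin N) ℂ | w 1 b * ‖Y b‖ < Rs / 4} := by ext Y; simp
      rw [this]
      exact isOpen_iInter_of_finite fun b => isOpen_lt (continuous_const.mul (continuous_apply b).norm) continuous_const
    have han := Literature.Analysis.Complex.SCV.analyticOnNhd_of_differentiableOn hdiff hopen
    exact han.contDiffOn_of_completeSpace.sub (ContinuousLinearMap.contDiff _).contDiffOn

end Socket

end Summit.QuantumFields.YangMills.Theorems.K0Stub1FlatChartRemainderP

end
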